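import Summits.ABC.IUTFork.LDHSlotResidueGoodShare
import Mathlib.Algebra.BigOperators.Fin
import Mathlib.Tactic.Positivity
import Mathlib.Tactic.Ring
import Mathlib.Tactic.Linarith
import HarnessLib

/-!
# The fork at [IUTchIII] Corollary 3.12, L-DH level: the (Ind1) slot residue at a MIXED prime, SHARP form —
# `(1/ℓ⋇)Σ_j (1 − ω_b^j)·a_j(p) ≤ slotResidue_p`, additivity over the primes, and the good-share bound SUMMED over
# the support primes of a genuine input / of every datum at the `λ`-line

Record-only PROOF file (D-0012) of the abc-iut cell (block C / W6 seat abc-iut-w6-d115, gen 2); sequel to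
abc-iut-w6-d018's `LDHSlotResidueGoodShare.lean` (p433633: `ω_G·ndegLgpOn X {p} ≤ slotResidue X T` per prime and its
compositions), abc-iut-S8's `PilotSlotResidue{,Bounds,Support}.lean` / `LDHSlotResidue.lean`, abc-iut-S7's
`LDHSlotResiduePointPair.lean`; TAKES NO SIDE on [IUTchIII] Cor. 3.12 or [IUTchIV] Thm. 1.10. Sources: Dupuy–Hilado,
arXiv:2004.13228 [DupuyHilado2025] §3.3, §3.6 (the probability space `(V(F)_p, Pr)`, product weights on collections),
§4.7 ((Ind1)), §4.11–4.12 (hull of `U_Θ`); S. Mochizuki, *IUT IV* [Mochizuki2012], proof of Thm. 1.10 Step (v) p. 27–28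
("`i†` to be `j`"; "after symmetrizing … does not affect the computation of the upper bound"), Step (vi) p. 29 (no theta
gain at `v ∉ V^bad`); cell notes HOME/plan/c312/STEPV-IND1-NOTE.md §4, HOME/staging/w6/w6-d018/SIZING-R2-TARGET1-hvol-slot-residue.md (C).

NOTATION (pilot data `X` over `F`, prime `p`, `θ_j = slotValue`, `μ(v) = P_q(v)·ln|κ(v)|/n_v`): `a_j(p) := Σ_{v|p} θ_j(v)Pr(v)`
(last-slot marginal, `= j²·μ̄_p`, `μ̄_p := Σ_{v|p} μ(v)Pr(v)`), `ω_b(p) := Σ_{v|p, v∈S} Pr(v)`, `ω_g(p) := Σ_{v|p, v∉S} Pr(v) = 1 − ω_b(p)`.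
WHAT IS PROVED (finite-sum combinatorics over the typed `PilotData`, then compositions BY NAME):
* `sum_prodInit_mul_last_mul_prod_weight` — slot independence, first-`j`/last form:
  `Σ_{v⃗}(Π_{k<j} f(v⃗(k)))·g(v⃗(j))·Π_k Pr(v⃗(k)) = (Σ_v Pr(v)f(v))^j·Σ_v Pr(v)g(v)`;
* `slotResidue_eq_sum_singleton` — ADDITIVITY `slotResidue X T = Σ_{p∈T} slotResidue X {p}`;
* **`inner_defect_sum_ge_sharp`** / **`sharp_le_slotResidue_singleton`** — `(1/ℓ⋇)Σ_j (1 − ω_b(p)^j)·a_j(p) ≤ slotResidue X {p}`: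
  a collection with a good place among its FIRST `j` slots has least slot value `≤ 0` (w6-d018 used slot `0` only, factor
  `ω_g ≤ 1 − ω_b^j`); equivalently `ndegLgpOn X {p} − (1/ℓ⋇)Σ_j ω_b^j·a_j(p) ≤ slotResidue X {p}` — at a mixed prime the
  residue is the WHOLE `p`-part of `deĝ̲_lgp(P_Θ)` except an `ω_b^j`-weighted tail (summed in closed form, and shown to be
  attained when `θ` does not distinguish the bad places over `p`, in the sequel `LDHSlotResidueShareExact.lean`);
* **`sum_goodWeight_mul_ndegLgpOn_le_slotResidue`** (`_closed`) — the good-share bound SUMMED: `Σ_{p∈T} ω_g(p)·ndegLgpOn X {p} ≤ slotResidue X T`;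
* compositions (S8 `slotResidue_le_of_hullEstimateOf`, S7 `avgSq_eq`): `DHData.sum_goodWeight_mul_le_of_hullEstimateOf`,
  `DHData.sharp_le_of_hullEstimateOf`, and at the `λ`-line **`PointDict.sum_goodWeight_mul_le_of_hullVolumeAtDatum`**:
  `Cor22.HullVolumeAtDatum P l δ` forces `(l(l+1)/12)·Σ_{p∈T(I)} ω_g(p)·μ̄_p(T) ≤ δ` for EVERY genuine datum `T` at `(P,l)` —
  the TOTAL good-share `q`-mass of the point over the mixed primes of `F_mod` is bounded by `δ` (`= B(P,l)` in the `hvol`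
  binder of `Conditional/AbcOfS*.lean`, child (ii′) of stmt-ABC-19678, UNION line); vacuous iff no support prime is mixed.
[cite: DupuyHilado2025, §3.3, §3.6, §4.7, §4.11, §4.12] [cite: Mochizuki2012, IUTchIV Thm. 1.10 Step (v)–(vi) p. 27–29]
[claim: Mochizuki2012, status: disputed] for every IUT quotation. No datum is constructed; typed ≠ endorsed.
-/

noncomputable section

namespace Literature.IUT.LogVolume

open NumberField IsDedekindDomain Finset

namespace PilotData

variable {F : Type*} [Field F] [NumberField F] (X : PilotData F)

/-! ## Plumbing: marginals of the product weights on collections -/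

/-- Full factorisation of a product-weighted sum over collections: `Σ_{e} Π_k (w(e k)·f_k(e k)) = Π_k Σ_s w(s)·f_k(s)`.
[folklore] -/
private theorem sum_prod_mul_eq_prod_sum {S : Type*} [Fintype S] [DecidableEq S] (w : S → ℝ) {n : ℕ}
    (f : Fin n → S → ℝ) :
    ∑ e : Fin n → S, ∏ k, (w (e k) * f k (e k)) = ∏ k : Fin n, ∑ s : S, w s * f k s := by
  rw [Finset.prod_univ_sum, Fintype.piFinset_univ]

/-- **Independence of the slots, first-`m`/last form.** For weights `w` on `S`, a factor `f` read at each of the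
first `m` slots and a factor `g` read at the last slot of a collection `e ∈ S^{m+1}`:
`Σ_e (Π_{k<m} f(e k))·g(e m)·Π_k w(e k) = (Σ_s w(s)f(s))^m · Σ_s w(s)g(s)`. [cite: DupuyHilado2025, §3.6] -/
theorem sum_prodInit_mul_last_mul_prod_weight {S : Type*} [Fintype S] [DecidableEq S] (w : S → ℝ)
    {m : ℕ} (f g : S → ℝ) :
    ∑ e : Fin (m + 1) → S, ((∏ j : Fin m, f (e (Fin.castSucc j))) * g (e (Fin.last m))) * ∏ k, w (e k) =
      (∑ s, w s * f s) ^ m * ∑ s, w s * g s := by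
  set h : Fin (m + 1) → S → ℝ := fun k s => if k = Fin.last m then g s else f s with hh
  have hcast : ∀ (j : Fin m) (s : S), h (Fin.castSucc j) s = f s := fun j s => by
    simp only [hh, (Fin.castSucc_lt_last j).ne, if_false]
  have hlast : ∀ s, h (Fin.last m) s = g s := fun s => by simp only [hh, if_true]
  have key : ∀ e : Fin (m + 1) → S,
      ((∏ j : Fin m, f (e (Fin.castSucc j))) * g (e (Fin.last m))) * ∏ k, w (e k) =
        ∏ k, (w (e k) * h k (e k)) := by
    intro e
    rw [Finset.prod_mul_distrib, Fin.prod_univ_castSucc (fun k => h k (e k))]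
    simp only [hcast, hlast]
    ring
  rw [Finset.sum_congr rfl (fun e _ => key e), sum_prod_mul_eq_prod_sum,
    Fin.prod_univ_castSucc (fun k => ∑ s, w s * h k s)]
  simp only [hcast, hlast, Finset.prod_const, Finset.card_univ, Fintype.card_fin]

/-- **The last-slot marginal**: for probability weights (`Σ_s w(s) = 1`), `Σ_e g(e m)·Π_k w(e k) = Σ_s g(s)·w(s)`.
[cite: DupuyHilado2025, §3.6] -/
theorem sum_last_mul_prod_weight {S : Type*} [Fintype S] [DecidableEq S] (w : S → ℝ)
    (hw : ∑ s, w s = 1) {m : ℕ} (g : S → ℝ) :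
    ∑ e : Fin (m + 1) → S, g (e (Fin.last m)) * ∏ k, w (e k) = ∑ s, g s * w s := by
  have h := sum_prodInit_mul_last_mul_prod_weight w (m := m) (fun _ => (1 : ℝ)) g
  simp only [Finset.prod_const_one, one_mul, mul_one, hw, one_pow] at h
  rw [h]
  exact Finset.sum_congr rfl fun s _ => mul_comm _ _

/-! ## Additivity over the index set -/

/-- `ndegLgpOn X T = Σ_{p∈T} ndegLgpOn X {p}`. [cite: DupuyHilado2025, Def. 3.6.3] -/
theorem ndegLgpOn_eq_sum_singleton (T : Finset ℕ) : X.ndegLgpOn T = ∑ p ∈ T, X.ndegLgpOn {p} := by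
  unfold ndegLgpOn
  exact Finset.sum_congr rfl fun p _ => by rw [Finset.sum_singleton]

/-- `ndegLgpSlotMin X T = Σ_{p∈T} ndegLgpSlotMin X {p}`. [cite: DupuyHilado2025, Def. 3.6.3] -/
theorem ndegLgpSlotMin_eq_sum_singleton (T : Finset ℕ) :
    X.ndegLgpSlotMin T = ∑ p ∈ T, X.ndegLgpSlotMin {p} := by
  unfold ndegLgpSlotMin
  exact Finset.sum_congr rfl fun p _ => by rw [Finset.sum_singleton]

/-- **Additivity of the residue**: `slotResidue X T = Σ_{p∈T} slotResidue X {p}`. [cite: DupuyHilado2025, §4.7] -/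
theorem slotResidue_eq_sum_singleton (T : Finset ℕ) : X.slotResidue T = ∑ p ∈ T, X.slotResidue {p} := by
  unfold slotResidue
  rw [X.ndegLgpOn_eq_sum_singleton T, X.ndegLgpSlotMin_eq_sum_singleton T, ← Finset.sum_sub_distrib]

/-- The residue at one prime as the weighted sum of the slot defects. [cite: DupuyHilado2025, §4.7] -/
theorem slotResidue_singleton_eq_sum (p : ℕ) :
    X.slotResidue {p} = (1 / (X.lstar : ℝ)) * ∑ i : Fin X.lstar,
      ∑ e : Fin ((i : ℕ) + 1 + 1) → placesOver F p,
        (X.slotValue i (e (Fin.last _)).1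
          - Finset.univ.inf' Finset.univ_nonempty (fun k => X.slotValue i (e k).1)) *
          ∏ k, weight F (e k).1 := by
  rw [slotResidue_eq_sum, Finset.sum_singleton]

/-! ## Signs and the bad / good weights -/

/-- `μ(v) = P_q(v)·ln|κ(v)|/n_v ≥ 0` (`P_q(v) = ord_v(q_v)/(2l) > 0` on `S`, `0` off `S`). [cite: DupuyHilado2025, §3.3–3.4] -/
theorem qPilot_mul_logNorm_div_nonneg (v : HeightOneSpectrum (𝓞 F)) :
    0 ≤ X.qPilot v * logNorm F v / (localDegree F v : ℝ) := by
  classical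
  refine div_nonneg (mul_nonneg ?_ (logNorm_pos F v).le) (Nat.cast_nonneg _)
  by_cases hv : v ∈ X.S
  · have hq : X.qPilot v = (X.ordq v : ℝ) / (2 * X.l) := by
      simp only [qPilot, FinDivisor.of, Finsupp.finsetSum_apply, Finsupp.single_apply, Finset.sum_ite_eq',
        if_pos hv]
    rw [hq]
    exact div_nonneg (by exact_mod_cast (X.ordq_pos hv).le) X.two_mul_l_pos.le
  · have hq : X.qPilot v = 0 := by
      simp only [qPilot, FinDivisor.of, Finsupp.finsetSum_apply, Finsupp.single_apply, Finset.sum_ite_eq',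
        if_neg hv]
    rw [hq]

/-- `θ_j(v) = j²·μ(v) ≥ 0` — a `private`, universe-polymorphic copy of abc-iut-c312-d1's `PilotData.slotValue_nonneg`
(`LDHGenuineHullRegimeSlack.lean`, stated over `F : Type` through `ValLine.thetaPilot_nonneg`), kept local so that this
file stays over `F : Type*` like its parents. [cite: DupuyHilado2025, §3.3–3.4] -/
private theorem zero_le_slotValue (i : Fin X.lstar) (v : HeightOneSpectrum (𝓞 F)) : 0 ≤ X.slotValue i v := by
  rw [slotValue_eq_sq_mul]
  exact mul_nonneg (sq_nonneg _) (X.qPilot_mul_logNorm_div_nonneg v)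

/-- The last-slot marginal `a_j(p) = Σ_{v|p} θ_j(v)·Pr(v)` is `≥ 0`. [cite: DupuyHilado2025, §3.4, §3.6] -/
theorem sum_slotValue_mul_weight_nonneg (p : ℕ) (i : Fin X.lstar) :
    0 ≤ ∑ v : placesOver F p, X.slotValue i v.1 * weight F v.1 :=
  Finset.sum_nonneg fun v _ => mul_nonneg (X.zero_le_slotValue i v.1) (weight_nonneg F v.1)

open scoped Classical in
/-- `0 ≤ ω_b(p)`. [cite: DupuyHilado2025, §3.6] -/
theorem badWeight_nonneg (p : ℕ) :
    0 ≤ ∑ v ∈ Finset.univ.filter (fun v : placesOver F p => v.1 ∈ X.S), weight F v.1 :=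
  Finset.sum_nonneg fun v _ => weight_nonneg F v.1

open scoped Classical in
/-- `0 ≤ ω_g(p)`. [cite: DupuyHilado2025, §3.6] -/
theorem goodWeight_nonneg (p : ℕ) :
    0 ≤ ∑ v ∈ Finset.univ.filter (fun v : placesOver F p => v.1 ∉ X.S), weight F v.1 :=
  Finset.sum_nonneg fun v _ => weight_nonneg F v.1

open scoped Classical in
/-- `ω_b(p) ≤ 1`. [cite: DupuyHilado2025, §3.6] -/
theorem badWeight_le_one (p : ℕ) [Fact p.Prime] :
    ∑ v ∈ Finset.univ.filter (fun v : placesOver F p => v.1 ∈ X.S), weight F v.1 ≤ 1 := by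
  have h := X.goodWeight_eq_one_sub_badWeight p
  linarith [X.goodWeight_nonneg p]

open scoped Classical in
/-- The bad weight as an indicator sum: `ω_b(p) = Σ_{v : V(F)_p} Pr(v)·𝟙_S(v)`. [cite: DupuyHilado2025, §3.6] -/
theorem badWeight_eq_sum_indicator (p : ℕ) :
    ∑ v : placesOver F p, weight F v.1 * (if v.1 ∈ X.S then (1 : ℝ) else 0) =
      ∑ v ∈ Finset.univ.filter (fun v : placesOver F p => v.1 ∈ X.S), weight F v.1 := by
  rw [Finset.sum_filter]
  refine Finset.sum_congr rfl fun v _ => ?_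
  split_ifs <;> simp

/-! ## The sharp lower bound per `(p, j)` and per prime -/

open scoped Classical in
/-- **Per procession index, sharp**: for a prime `p` and `j = i+1`,
`(1 − ω_b(p)^j)·a_j(p) ≤ Σ_{v⃗∈V(F)_p^{j+1}} (θ_j(v⃗(j)) − min_k θ_j(v⃗(k)))·Π_k Pr(v⃗(k))`. A collection with a good
place (`θ_j = 0` there, [IUTchIV] Step (vi)) among its first `j` slots has least slot value `≤ 0`, so its defect is at
least its last-slot gain; the remaining collections (first `j` slots all bad, total weight `ω_b^j` against the
last-slot marginal) have nonnegative defect. [cite: Mochizuki2012, IUTchIV Thm. 1.10 Step (v)–(vi) p. 27–29] -/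
theorem inner_defect_sum_ge_sharp (p : ℕ) [Fact p.Prime] (i : Fin X.lstar) :
    (1 - (∑ v ∈ Finset.univ.filter (fun v : placesOver F p => v.1 ∈ X.S), weight F v.1) ^ ((i : ℕ) + 1)) *
        ∑ v : placesOver F p, X.slotValue i v.1 * weight F v.1 ≤
      ∑ e : Fin ((i : ℕ) + 1 + 1) → placesOver F p,
        (X.slotValue i (e (Fin.last _)).1
          - Finset.univ.inf' Finset.univ_nonempty (fun k => X.slotValue i (e k).1)) *
          ∏ k, weight F (e k).1 := by
  classical
  set m : ℕ := (i : ℕ) + 1 with hm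
  set w : placesOver F p → ℝ := fun v => weight F v.1 with hw
  set b : placesOver F p → ℝ := fun v => if v.1 ∈ X.S then (1 : ℝ) else 0 with hb
  set θ : placesOver F p → ℝ := fun v => X.slotValue i v.1 with hθ
  -- the two marginals
  have hA : ∑ e : Fin (m + 1) → placesOver F p, θ (e (Fin.last m)) * ∏ k, w (e k) =
      ∑ v : placesOver F p, X.slotValue i v.1 * weight F v.1 :=
    sum_last_mul_prod_weight w (sum_weight_placesOver p) θ
  have hB : ∑ e : Fin (m + 1) → placesOver F p,
      ((∏ j : Fin m, b (e (Fin.castSucc j))) * θ (e (Fin.last m))) * ∏ k, w (e k) =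
      (∑ v ∈ Finset.univ.filter (fun v : placesOver F p => v.1 ∈ X.S), weight F v.1) ^ m *
        ∑ v : placesOver F p, X.slotValue i v.1 * weight F v.1 := by
    rw [sum_prodInit_mul_last_mul_prod_weight w b θ, X.badWeight_eq_sum_indicator p]
    congr 1
    exact Finset.sum_congr rfl fun v _ => mul_comm _ _
  -- pointwise comparison
  have hpt : ∀ e : Fin (m + 1) → placesOver F p,
      θ (e (Fin.last m)) * ∏ k, w (e k)
          - ((∏ j : Fin m, b (e (Fin.castSucc j))) * θ (e (Fin.last m))) * ∏ k, w (e k) ≤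
        (X.slotValue i (e (Fin.last _)).1
          - Finset.univ.inf' Finset.univ_nonempty (fun k => X.slotValue i (e k).1)) *
          ∏ k, weight F (e k).1 := by
    intro e
    have hwnn : 0 ≤ ∏ k, w (e k) := prod_weight_nonneg e
    have hdef : Finset.univ.inf' Finset.univ_nonempty (fun k => X.slotValue i (e k).1) ≤
        X.slotValue i (e (Fin.last _)).1 := Finset.inf'_le _ (Finset.mem_univ _)
    by_cases hall : ∀ j : Fin m, (e (Fin.castSucc j)).1 ∈ X.S
    · have h1 : ∏ j : Fin m, b (e (Fin.castSucc j)) = 1 :=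
        Finset.prod_eq_one fun j _ => by simp only [hb, hall j, if_true]
      rw [h1, one_mul, sub_self]
      exact mul_nonneg (sub_nonneg.mpr hdef) hwnn
    · push Not at hall
      obtain ⟨j, hj⟩ := hall
      have h0 : ∏ j : Fin m, b (e (Fin.castSucc j)) = 0 :=
        Finset.prod_eq_zero (Finset.mem_univ j) (by simp only [hb, hj, if_false])
      have hinf : Finset.univ.inf' Finset.univ_nonempty (fun k => X.slotValue i (e k).1) ≤ 0 :=
        (Finset.inf'_le _ (Finset.mem_univ (Fin.castSucc j))).trans
          (X.slotValue_eq_zero_of_not_mem i hj).le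
      rw [h0, zero_mul, zero_mul, sub_zero]
      have : θ (e (Fin.last m)) ≤ X.slotValue i (e (Fin.last _)).1
          - Finset.univ.inf' Finset.univ_nonempty (fun k => X.slotValue i (e k).1) := by
        simp only [hθ]; linarith
      exact mul_le_mul_of_nonneg_right this hwnn
  calc (1 - (∑ v ∈ Finset.univ.filter (fun v : placesOver F p => v.1 ∈ X.S), weight F v.1) ^ m) *
        ∑ v : placesOver F p, X.slotValue i v.1 * weight F v.1
      = (∑ e : Fin (m + 1) → placesOver F p, θ (e (Fin.last m)) * ∏ k, w (e k))
          - ∑ e : Fin (m + 1) → placesOver F p,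
              ((∏ j : Fin m, b (e (Fin.castSucc j))) * θ (e (Fin.last m))) * ∏ k, w (e k) := by
        rw [hA, hB]; ring
    _ = ∑ e : Fin (m + 1) → placesOver F p,
          (θ (e (Fin.last m)) * ∏ k, w (e k)
            - ((∏ j : Fin m, b (e (Fin.castSucc j))) * θ (e (Fin.last m))) * ∏ k, w (e k)) :=
        (Finset.sum_sub_distrib _ _).symm
    _ ≤ _ := Finset.sum_le_sum fun e _ => hpt e

open scoped Classical in
/-- **The sharp lower bound at a prime**: `(1/ℓ⋇)·Σ_j (1 − ω_b(p)^j)·a_j(p) ≤ slotResidue X {p}`.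
[cite: Mochizuki2012, IUTchIV Thm. 1.10 Step (v) p. 27–28] -/
theorem sharp_le_slotResidue_singleton (p : ℕ) [Fact p.Prime] :
    (1 / (X.lstar : ℝ)) * ∑ i : Fin X.lstar,
        (1 - (∑ v ∈ Finset.univ.filter (fun v : placesOver F p => v.1 ∈ X.S), weight F v.1) ^ ((i : ℕ) + 1)) *
          ∑ v : placesOver F p, X.slotValue i v.1 * weight F v.1 ≤ X.slotResidue {p} := by
  rw [slotResidue_singleton_eq_sum]
  exact mul_le_mul_of_nonneg_left (Finset.sum_le_sum fun i _ => X.inner_defect_sum_ge_sharp p i) (by positivity)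

open scoped Classical in
/-- The sharp bound rewritten with w6-d018's marginal `ndegLgpOn_singleton_eq`:
`ndegLgpOn X {p} − (1/ℓ⋇)·Σ_j ω_b(p)^j·a_j(p) ≤ slotResidue X {p}` — the residue at a mixed prime is the whole `p`-part
of `deĝ̲_lgp(P_Θ)` except a tail weighted by `ω_b^j`. [cite: Mochizuki2012, IUTchIV Thm. 1.10 Step (v) p. 27–28] -/
theorem ndegLgpOn_sub_tail_le_slotResidue_singleton (p : ℕ) [Fact p.Prime] :
    X.ndegLgpOn {p} - (1 / (X.lstar : ℝ)) * ∑ i : Fin X.lstar,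
        (∑ v ∈ Finset.univ.filter (fun v : placesOver F p => v.1 ∈ X.S), weight F v.1) ^ ((i : ℕ) + 1) *
          ∑ v : placesOver F p, X.slotValue i v.1 * weight F v.1 ≤ X.slotResidue {p} := by
  have h := X.sharp_le_slotResidue_singleton p
  rw [X.ndegLgpOn_singleton_eq p, ← mul_sub, ← Finset.sum_sub_distrib]
  refine le_of_eq_of_le ?_ h
  congr 1
  exact Finset.sum_congr rfl fun i _ => by ring

/-! ## The good-share bound summed over the primes -/

open scoped Classical in
/-- **Good-share lower bound over a finite set of primes** (w6-d018's `mul_ndegLgpOn_singleton_le_slotResidue_singleton`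
at `G :=` the good places, summed by additivity): `Σ_{p∈T} ω_g(p)·ndegLgpOn X {p} ≤ slotResidue X T`.
[cite: Mochizuki2012, IUTchIV Thm. 1.10 Step (v)–(vi) p. 27–29] -/
theorem sum_goodWeight_mul_ndegLgpOn_le_slotResidue (T : Finset ℕ) (hT : ∀ p ∈ T, p.Prime) :
    ∑ p ∈ T, (∑ v ∈ Finset.univ.filter (fun v : placesOver F p => v.1 ∉ X.S), weight F v.1) * X.ndegLgpOn {p} ≤
      X.slotResidue T := by
  rw [X.slotResidue_eq_sum_singleton T]
  refine Finset.sum_le_sum fun p hp => ?_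
  haveI : Fact p.Prime := ⟨hT p hp⟩
  exact X.mul_ndegLgpOn_singleton_le_slotResidue_singleton p _ fun v hv i =>
    X.slotValue_eq_zero_of_not_mem i (Finset.mem_filter.mp hv).2

open scoped Classical in
/-- … in closed form: `((ℓ⋇+1)(2ℓ⋇+1)/6)·Σ_{p∈T} ω_g(p)·μ̄_p ≤ slotResidue X T`, `μ̄_p = Σ_{v|p} μ(v)Pr(v)` — the good-share
of the mixed part of `deĝ̲_lgp(P_Θ) = ((l+1)/24)·deĝ̲(𝔮)` in total. [cite: Mochizuki2012, IUTchIV Thm. 1.10 Step (v) p. 27–28] -/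
theorem sum_goodWeight_mul_closed_le_slotResidue (T : Finset ℕ) (hT : ∀ p ∈ T, p.Prime) :
    (((X.lstar : ℝ) + 1) * (2 * X.lstar + 1) / 6) *
        ∑ p ∈ T, (∑ v ∈ Finset.univ.filter (fun v : placesOver F p => v.1 ∉ X.S), weight F v.1) *
          ∑ v : placesOver F p, (X.qPilot v.1 * logNorm F v.1 / (localDegree F v.1 : ℝ)) * weight F v.1 ≤
      X.slotResidue T := by
  rw [Finset.mul_sum]
  refine le_of_eq_of_le (Finset.sum_congr rfl fun p hp => ?_) (X.sum_goodWeight_mul_ndegLgpOn_le_slotResidue T hT)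
  haveI : Fact p.Prime := ⟨hT p hp⟩
  rw [X.ndegLgpOn_singleton_closed p]
  ring

end PilotData

end Literature.IUT.LogVolume

/-! ## Compositions with abc-iut-S8 / S7 BY NAME: genuine inputs and the `λ`-line -/

namespace Summit.ABC.IUTFork

open Literature.IUT.HodgeTheaters Literature.IUT.LogVolume NumberField IsDedekindDomain
open Literature.NumberTheory.DiophantineGeometry.GenEll
open scoped Classical

namespace DHData

section Input

variable {F₀ : Type} [Field F₀] [NumberField F₀] {K : Type} [Field K] [NumberField K] [Algebra F₀ K]
variable (I : ThetaVolumeInput F₀ K)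

/-- **Every hull-volume estimate of a genuine Θ-volume input dominates the TOTAL good-share mass**:
`I.HullEstimateOf δ → ((ℓ⋇+1)(2ℓ⋇+1)/6)·Σ_{p∈T(I)} ω_g(p)·μ̄_p ≤ δ` (abc-iut-S8's `slotResidue_le_of_hullEstimateOf` ∘
`sum_goodWeight_mul_closed_le_slotResidue`; the support primes are prime, `prime_of_mem_supportPrimes`).
[cite: Mochizuki2012, IUTchIV Thm. 1.10 Step (v) p. 27–28] [cite: DupuyHilado2025, §4.7, §4.12] -/
theorem sum_goodWeight_mul_le_of_hullEstimateOf {δ : ℝ} (h : I.HullEstimateOf δ) :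
    (((I.X.lstar : ℝ) + 1) * (2 * I.X.lstar + 1) / 6) *
        ∑ p ∈ I.supportPrimes, (∑ v ∈ Finset.univ.filter (fun v : placesOver F₀ p => v.1 ∉ I.X.S), weight F₀ v.1) *
          ∑ v : placesOver F₀ p, (I.X.qPilot v.1 * logNorm F₀ v.1 / (localDegree F₀ v.1 : ℝ)) * weight F₀ v.1 ≤
      δ :=
  (I.X.sum_goodWeight_mul_closed_le_slotResidue I.supportPrimes fun _ hp => I.prime_of_mem_supportPrimes hp).trans
    (slotResidue_le_of_hullEstimateOf I h)

/-- **… and the sharp form at each support prime**: `I.HullEstimateOf δ → (1/ℓ⋇)·Σ_j (1 − ω_b(p)^j)·a_j(p) ≤ δ` for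
`p ∈ T(I)` (`sharp_le_slotResidue_singleton`, monotonicity `slotResidue_mono`, S8's `slotResidue_le_of_hullEstimateOf`).
[cite: Mochizuki2012, IUTchIV Thm. 1.10 Step (v) p. 27–28] [cite: DupuyHilado2025, §4.7, §4.12] -/
theorem sharp_le_of_hullEstimateOf {δ : ℝ} (h : I.HullEstimateOf δ) {p : ℕ} [Fact p.Prime]
    (hp : p ∈ I.supportPrimes) :
    (1 / (I.X.lstar : ℝ)) * ∑ i : Fin I.X.lstar,
        (1 - (∑ v ∈ Finset.univ.filter (fun v : placesOver F₀ p => v.1 ∈ I.X.S), weight F₀ v.1) ^ ((i : ℕ) + 1)) *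
          ∑ v : placesOver F₀ p, I.X.slotValue i v.1 * weight F₀ v.1 ≤ δ :=
  ((I.X.sharp_le_slotResidue_singleton p).trans (I.X.slotResidue_mono (Finset.singleton_subset_iff.mpr hp))).trans
    (slotResidue_le_of_hullEstimateOf I h)

end Input

end DHData

namespace PointDict

variable {P : NFPoint} {l : ℕ}

/-- **At the `λ`-line, per datum**: `T.HullEstimateOf δ` forces `(l(l+1)/12)·Σ_{p∈T(I)} ω_g(p)·μ̄_p(T) ≤ δ` over `F_mod`
(`μ̄_p(T) = Σ_{v|p} μ_T(v)Pr(v)` with `μ_T` as in abc-iut-S7's `mu_eq`; procession factor `(ℓ⋇+1)(2ℓ⋇+1)/6 = l(l+1)/12`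
by `avgSq_eq`). [cite: Mochizuki2012, IUTchIV Thm. 1.10 Step (v) p. 27–28] -/
theorem sum_goodWeight_mul_le_of_hullEstimateOf (T : Cor22.ThetaVolumeDatumAt P l) {δ : ℝ}
    (h : T.HullEstimateOf δ) :
    (letI := T.instFieldF; letI := T.instNumberFieldF; letI := T.instAlgebraF; letI := T.instFieldK
     letI := T.instNumberFieldK; letI := T.instAlgebraK; letI := T.instFieldFbar; letI := T.instAlgebraFbar
     letI := T.instAlgebraKFbar; letI := T.instIsElliptic
     ((l : ℝ) * ((l : ℝ) + 1) / 12) *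
         ∑ p ∈ T.I.supportPrimes,
           (∑ v ∈ Finset.univ.filter (fun v : placesOver (fieldOfModuli T.E) p => v.1 ∉ T.I.X.S),
               weight (fieldOfModuli T.E) v.1) *
             ∑ v : placesOver (fieldOfModuli T.E) p,
               (T.I.X.qPilot v.1 * logNorm (fieldOfModuli T.E) v.1 / (localDegree (fieldOfModuli T.E) v.1 : ℝ)) *
                 weight (fieldOfModuli T.E) v.1 ≤ δ) := by
  letI := T.instFieldF; letI := T.instNumberFieldF; letI := T.instAlgebraF; letI := T.instFieldK
  letI := T.instNumberFieldK; letI := T.instAlgebraK; letI := T.instFieldFbar; letI := T.instAlgebraFbar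
  letI := T.instAlgebraKFbar; letI := T.instIsElliptic
  have h1 := DHData.sum_goodWeight_mul_le_of_hullEstimateOf T.I h
  rw [avgSq_eq T] at h1
  exact h1

/-- **`Cor22.HullVolumeAtDatum P l δ` bounds the TOTAL good-share `q`-mass of EVERY genuine datum at `(P, l)`**: for
every `T : Cor22.ThetaVolumeDatumAt P l`, `(l(l+1)/12)·Σ_{p∈T(I)} ω_g(p)·μ̄_p(T) ≤ δ`. With `δ = B(P,l)` this is what the
`hvol` binder of `Conditional/AbcOfS*.lean` (child (ii′) of stmt-ABC-19678 on the UNION line) asserts about the POINT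
beyond print: the whole part of `((l+1)/24)·log(q)` carried by good places over mixed primes of `F_mod` is bounded by
`B(P,l)` — summed over the primes, not prime by prime; vacuous iff no support prime is mixed (e.g. `d_mod = 1`).
Nothing asserted about the existence of data. [claim: Mochizuki2012, status: disputed] -/
theorem sum_goodWeight_mul_le_of_hullVolumeAtDatum {δ : ℝ} (h : Cor22.HullVolumeAtDatum P l δ)
    (T : Cor22.ThetaVolumeDatumAt P l) :
    (letI := T.instFieldF; letI := T.instNumberFieldF; letI := T.instAlgebraF; letI := T.instFieldK
     letI := T.instNumberFieldK; letI := T.instAlgebraK; letI := T.instFieldFbar; letI := T.instAlgebraFbar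
     letI := T.instAlgebraKFbar; letI := T.instIsElliptic
     ((l : ℝ) * ((l : ℝ) + 1) / 12) *
         ∑ p ∈ T.I.supportPrimes,
           (∑ v ∈ Finset.univ.filter (fun v : placesOver (fieldOfModuli T.E) p => v.1 ∉ T.I.X.S),
               weight (fieldOfModuli T.E) v.1) *
             ∑ v : placesOver (fieldOfModuli T.E) p,
               (T.I.X.qPilot v.1 * logNorm (fieldOfModuli T.E) v.1 / (localDegree (fieldOfModuli T.E) v.1 : ℝ)) *
                 weight (fieldOfModuli T.E) v.1 ≤ δ) :=
  sum_goodWeight_mul_le_of_hullEstimateOf T (h T)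

end PointDict

end Summit.ABC.IUTFork

end
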